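import Literature.AlgebraicGeometry.Motives.HodgeThetaSubalgebraUnitaryFourOddCore
import HarnessLib

/-!
# The `Θ`-subalgebra theorem for unitary multiplicities `(5, b)`, `b ≡ 2, 4 (mod 5)` — complex–Hermitian core
# (Ribet 1983, Thm. 3 at `(n′, n″) = (5, n″)`, `n″ ≡ ±2 (mod 5)`: in particular the primes `17 = 5 + 12`, `19 = 5 + 14`)

Family `hodge`, layer `Literature/AlgebraicGeometry/Motives` (pure linear algebra over `ℂ`; no geometry). Research
context: cell `pub-hodge-ring2` (HONEST FRAMING: research route conditional on HC_CM; not a corollary; Q11.4-sentence-2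
already refuted in dim ≥ 3), Literature lane gen 83, programme R65. UNCONDITIONAL; theorems only, no definition, no
named fact (D-0026), no `sorry`. With all three raising-rank lemmas of the tree — Φ (`exists_raise_rank_gt_of_two_le`),
Ψ-counting (`exists_raise_rank_gt_of_finrank_eq_succ`) and Ψ-core (`exists_raise_rank_gt_of_psi_core`) — the rank-FIVE
raising lemma holds whenever `dim Q ≥ 7` is odd (rank `4 → 5` by the `(4 | odd)` core) or `dim Q ≥ 11` (rank `4 → 5` by
counting); ranks `2 → 3 → 4` always by the Ψ-core route (types `(3|2)`, `(2|3)`). The Levi step `(5 | b − 5)` then runs the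
induction along `b ≡ 2, 4 (mod 5)` down to `(5|2)` (the `(odd|2)` core) and `(5|4)` (`UnitaryCoprimeStep.eq_top_five_four`);
the classes `b ≡ 1, 3 (mod 5)` end at `(5|6)`, `(5|8)`, which are NOT reached (at maximal rank `4` both routes fail there).

* §1 **`UnitaryFive.exists_raise_onto_five`** — `dim P = 5`, `dim Q ≥ 7`, `dim Q` odd or `≥ 11` ⟹ a raising operator onto `P`.
* §2 **`UnitaryFive.eq_top`, `eq_top'`** — the `(5 | b)` core for `b % 5 ∈ {2, 4}`, and its mirror.

## References
* [Ribet1983] K. A. Ribet, Amer. J. Math. 105 (1983), Thm. 3.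
* [Gordon1997] B. B. Gordon, *A survey of the Hodge conjecture for abelian varieties*, Thm. 6.3 (3), pp. 18–19.
* [Deligne1982HodgeCycles] P. Deligne, LNM 900 (1982), I §3 Prop. 3.4, 3.6.
-/

noncomputable section

namespace Literature.AlgebraicGeometry.Motives

namespace HodgeStructure

section RankFive

universe u

variable {W : Type u} [AddCommGroup W] [Module ℂ W]

/-- **The rank-five raising lemma** (`dim P = 5`, `dim Q ≥ 7`, `dim Q` odd or `≥ 11`). [cite: Ribet1983, Thm. 3]
[cite: Gordon1997, Thm. 6.3 (3)] [cite: Deligne1982HodgeCycles, I §3 Prop. 3.6] -/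
theorem UnitaryFive.exists_raise_onto_five [FiniteDimensional ℂ W] {𝔊 : Submodule ℂ (Module.End ℂ W)}
    (hbr : ∀ Y ∈ 𝔊, ∀ Z ∈ 𝔊, Y * Z - Z * Y ∈ 𝔊)
    (hirr : ∀ U : Submodule ℂ W, (∀ A ∈ 𝔊, ∀ u ∈ U, A u ∈ U) → U = ⊥ ∨ U = ⊤)
    {Θ : Module.End ℂ W} (hΘ : Θ ∈ 𝔊) (hΘΘ : Θ * Θ = 1)
    {P Q : Submodule ℂ W} (hP : ∀ x, x ∈ P ↔ Θ x = x) (hQ : ∀ x, x ∈ Q ↔ Θ x = -x)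
    (hP5 : Module.finrank ℂ P = 5) (hQ7 : 7 ≤ Module.finrank ℂ Q)
    (hQr : Odd (Module.finrank ℂ Q) ∨ 11 ≤ Module.finrank ℂ Q)
    {s : W → W → ℂ} (hadd : ∀ x y z, s (x + y) z = s x z + s y z) (hsymm : ∀ x y, s y x = starRingEnd ℂ (s x y))
    (hPQ : ∀ p ∈ P, ∀ q ∈ Q, s p q = 0) (hdefP : ∀ p ∈ P, s p p = 0 → p = 0) (hdefQ : ∀ q ∈ Q, s q q = 0 → q = 0)
    (hadj : ∀ X ∈ 𝔊, ∃ Y ∈ 𝔊, ∀ x y, s (X x) y = s x (Y y)) :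
    ∃ B ∈ 𝔊, Θ * B = B ∧ B * Θ = -B ∧ ∀ p ∈ P, ∃ w, B w = p := by
  classical
  have hraiseval : ∀ Z : Module.End ℂ W, Θ * Z = Z → ∀ w, Z w ∈ P := fun Z hΘZ w =>
    (hP _).2 (by rw [← Module.End.mul_apply, hΘZ])
  have hle5 : ∀ B' : Module.End ℂ W, Θ * B' = B' → Module.finrank ℂ (LinearMap.range B') ≤ 5 := fun B' h => by
    rw [← hP5]
    exact Submodule.finrank_mono (by rintro _ ⟨w, rfl⟩; exact hraiseval B' h w)
  have honto : ∀ B' : Module.End ℂ W, Θ * B' = B' → 5 ≤ Module.finrank ℂ (LinearMap.range B') →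
      ∀ p ∈ P, ∃ w, B' w = p := by
    intro B' hΘB' h4 p hp
    have hle : LinearMap.range B' ≤ P := by rintro _ ⟨w, rfl⟩; exact hraiseval B' hΘB' w
    have heq : LinearMap.range B' = P := Submodule.eq_of_le_of_finrank_le hle (by rw [hP5]; exact h4)
    have hp' : p ∈ LinearMap.range B' := heq ▸ hp
    exact hp'
  have hup : ∀ B' ∈ 𝔊, Θ * B' = B' → B' * Θ = -B' →
      2 ≤ Module.finrank ℂ (LinearMap.range B') → Module.finrank ℂ (LinearMap.range B') ≤ 4 →
      ∃ B'' ∈ 𝔊, Θ * B'' = B'' ∧ B'' * Θ = -B'' ∧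
        Module.finrank ℂ (LinearMap.range B') < Module.finrank ℂ (LinearMap.range B'') := by
    intro B' hB' hΘB' hB'Θ h2 h4
    by_cases hr4 : Module.finrank ℂ (LinearMap.range B') = 4
    · rcases hQr with hodd | h11
      · -- Φ-route with the `(4 | odd)` core
        obtain ⟨k, hk⟩ := hodd
        refine UnitaryRaisingRank.exists_raise_rank_gt_of_two_le hbr hirr hΘ hΘΘ hP hQ hadd hsymm hPQ hdefP hdefQ
          hadj hB' hΘB' hB'Θ (by omega) (by omega) (by omega) fun U 𝔩 ι P' Q' hbr𝔩 hirr𝔩 hι hιι hP' hQ' hfinP' hfinQ'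
            hP'Q' hdefP' hdefQ' hadj𝔩 => ?_
        exact UnitaryFourOdd.eq_top hbr𝔩 hirr𝔩 hι hιι hP' hQ' (by rw [hfinP', hr4]) ⟨k - 2, by omega⟩
          (s := fun x y : U => s (x : W) y) (fun x y z => by simp only [Submodule.coe_add, hadd])
          (fun x y => hsymm x y) hP'Q' hdefP' hdefQ' hadj𝔩
      · -- Ψ-route, counting: `dim Q > 4 + C(4,2) = 10`
        have hc : (Module.finrank ℂ (LinearMap.range B')).choose 2 = 6 := by rw [hr4]; decide
        exact UnitaryRaisingRank.exists_raise_rank_gt_of_finrank_eq_succ hbr hirr hΘ hΘΘ hP hQ hB' hΘB' hB'Θ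
          (by omega) (by rw [hr4, hP5]) (by rw [hc]; omega) hadd hsymm hPQ hdefP hdefQ hadj
    · -- ranks `2`, `3`: Ψ-route with the cores `(3 | 2)`, `(2 | 3)`
      refine UnitaryRaisingRank.exists_raise_rank_gt_of_psi_core hbr hirr hΘ hΘΘ hP hQ hB' hΘB' hB'Θ (by omega)
        (by omega) (by omega) hadd hsymm hPQ hdefP hdefQ hadj fun U 𝔩 ι P' Q' hbr𝔩 hirr𝔩 hι hιι hP' hQ' hfinP' hfinQ'
          hP'Q' hdefP' hdefQ' hadj𝔩 => ?_
      by_cases hr2 : Module.finrank ℂ (LinearMap.range B') = 2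
      · exact UnitaryThreeCoprime.eq_top hbr𝔩 hirr𝔩 hι hιι hP' hQ' (by omega) (by rw [hfinQ', hr2]; omega)
          (s := fun x y : U => s (x : W) y) (fun x y z => by simp only [Submodule.coe_add, hadd])
          (fun x y => hsymm x y) hP'Q' hdefP' hdefQ' hadj𝔩
      · have hr3 : Module.finrank ℂ (LinearMap.range B') = 3 := by omega
        exact UnitaryTwoOdd.eq_top hbr𝔩 hirr𝔩 hι hιι hP' hQ' (by omega) (by rw [hfinQ', hr3]; exact ⟨1, rfl⟩)
          (s := fun x y : U => s (x : W) y) (fun x y z => by simp only [Submodule.coe_add, hadd])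
          (fun x y => hsymm x y) hP'Q' hdefP' hdefQ' hadj𝔩
  obtain ⟨B₂, hB₂, hΘB₂, hB₂Θ, hrk₂⟩ :=
    UnitaryThreeCoprime.exists_raise_rank_ge_two hbr hirr hΘ hΘΘ hP hQ (by omega) (by omega)
  have h₂ := hle5 B₂ hΘB₂
  by_cases h5 : 5 ≤ Module.finrank ℂ (LinearMap.range B₂)
  · exact ⟨B₂, hB₂, hΘB₂, hB₂Θ, honto B₂ hΘB₂ h5⟩
  obtain ⟨B₃, hB₃, hΘB₃, hB₃Θ, hrk₃⟩ := hup B₂ hB₂ hΘB₂ hB₂Θ hrk₂ (by omega)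
  have h₃ := hle5 B₃ hΘB₃
  by_cases h5' : 5 ≤ Module.finrank ℂ (LinearMap.range B₃)
  · exact ⟨B₃, hB₃, hΘB₃, hB₃Θ, honto B₃ hΘB₃ h5'⟩
  obtain ⟨B₄, hB₄, hΘB₄, hB₄Θ, hrk₄⟩ := hup B₃ hB₃ hΘB₃ hB₃Θ (by omega) (by omega)
  have h₄ := hle5 B₄ hΘB₄
  by_cases h5'' : 5 ≤ Module.finrank ℂ (LinearMap.range B₄)
  · exact ⟨B₄, hB₄, hΘB₄, hB₄Θ, honto B₄ hΘB₄ h5''⟩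
  obtain ⟨B₅, hB₅, hΘB₅, hB₅Θ, hrk₅⟩ := hup B₄ hB₄ hΘB₄ hB₄Θ (by omega) (by omega)
  have h₅ := hle5 B₅ hΘB₅
  exact ⟨B₅, hB₅, hΘB₅, hB₅Θ, honto B₅ hΘB₅ (by omega)⟩

end RankFive

/-! ### §2 The `(5 | b)` core, `b ≡ 2, 4 (mod 5)` -/

section Main

variable {W : Type*} [AddCommGroup W] [Module ℂ W]

universe u in
/-- The induction behind `UnitaryFive.eq_top` (strong induction on `dim Q ≡ 2, 4 (mod 5)`, the type `W` generalized;
base cases `(5|2)` — the `(odd|2)` core — and `(5|4)` — `UnitaryCoprimeStep.eq_top_five_four`; step by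
`UnitaryCoprimeStep.eq_top_of_onto_of_core` with the rank-five raising lemma). [cite: Ribet1983, Thm. 3]
[cite: Gordon1997, §6 (proof of Thm. 6.3.3, pp. 18–19)] -/
private theorem UnitaryFive.eq_top_aux (b : ℕ) :
    ∀ {W : Type u} [AddCommGroup W] [Module ℂ W] [FiniteDimensional ℂ W]
      {𝔊 : Submodule ℂ (Module.End ℂ W)},
      (∀ Y ∈ 𝔊, ∀ Z ∈ 𝔊, Y * Z - Z * Y ∈ 𝔊) →
      (∀ U : Submodule ℂ W, (∀ A ∈ 𝔊, ∀ u ∈ U, A u ∈ U) → U = ⊥ ∨ U = ⊤) →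
      ∀ {Θ : Module.End ℂ W}, Θ ∈ 𝔊 → Θ * Θ = 1 →
      ∀ {P Q : Submodule ℂ W}, (∀ x, x ∈ P ↔ Θ x = x) → (∀ x, x ∈ Q ↔ Θ x = -x) →
      Module.finrank ℂ P = 5 → Module.finrank ℂ Q = b → (b % 5 = 2 ∨ b % 5 = 4) →
      ∀ {s : W → W → ℂ}, (∀ x y z, s (x + y) z = s x z + s y z) →
      (∀ x y, s y x = starRingEnd ℂ (s x y)) →
      (∀ p ∈ P, ∀ q ∈ Q, s p q = 0) → (∀ p ∈ P, s p p = 0 → p = 0) → (∀ q ∈ Q, s q q = 0 → q = 0) →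
      (∀ X ∈ 𝔊, ∃ Y ∈ 𝔊, ∀ x y, s (X x) y = s x (Y y)) → 𝔊 = ⊤ := by
  induction b using Nat.strong_induction_on with
  | _ b ih =>
  intro W _ _ _ 𝔊 hbr hirr Θ hΘ hΘΘ P Q hP hQ hP5 hQb hbmod s hadd hsymm hPQ hdefP hdefQ hadj
  by_cases hb2 : b = 2
  · exact UnitaryTwoOdd.eq_top' hbr hirr hΘ hΘΘ hP hQ (by rw [hP5]; exact ⟨2, rfl⟩) (by rw [hQb, hb2]) hadd hsymm hPQ
      hdefP hdefQ hadj
  by_cases hb4 : b = 4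
  · exact UnitaryCoprimeStep.eq_top_five_four hbr hirr hΘ hΘΘ hP hQ hP5 (by rw [hQb, hb4]) hadd hsymm hPQ hdefP
      hdefQ hadj
  have hb7 : 7 ≤ b := by omega
  have hroute : Odd b ∨ 11 ≤ b := by
    rcases Nat.lt_or_ge b 11 with hlt | hge
    · left
      have : b = 7 ∨ b = 9 := by omega
      rcases this with h | h
      · exact ⟨3, by omega⟩
      · exact ⟨4, by omega⟩
    · exact Or.inr hge
  refine UnitaryCoprimeStep.eq_top_of_onto_of_core hbr hirr hΘ hΘΘ hP hQ hP5 hQb (by norm_num) (by omega) hadd hsymm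
    hPQ hdefP hdefQ hadj ?_ ?_
  · exact UnitaryFive.exists_raise_onto_five hbr hirr hΘ hΘΘ hP hQ hP5 (by rw [hQb]; exact hb7)
      (by rw [hQb]; exact hroute) hadd hsymm hPQ hdefP hdefQ hadj
  · intro 𝔩 ι P' Q' hbr𝔩 hirr𝔩 hι hιι hP' hQ' hfinP' hfinQ' hP'Q' hdefP' hdefQ' hadj𝔩
    exact ih (b - 5) (by omega) hbr𝔩 hirr𝔩 hι hιι hP' hQ' hfinP' hfinQ' (by omega) (s := fun x y : Q => s (x : W) y)
      (fun x y z => by simp only [Submodule.coe_add, hadd]) (fun x y => hsymm x y) hP'Q' hdefP' hdefQ' hadj𝔩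

/-- **THE `Θ`-SUBALGEBRA THEOREM FOR UNITARY MULTIPLICITIES `(5, b)`, `b ≡ 2, 4 (mod 5)` — complex Hermitian core**
(Ribet's Thm. 3 at `(5, n″)`, `n″ ≡ ±2 (mod 5)`, classification-free; `b = 7, 9, 12, 14, 17, 19, …`).
[cite: Ribet1983, Thm. 3] [cite: Gordon1997, Thm. 6.3 (3) and pp. 18–19] [cite: Deligne1982HodgeCycles, I §3 Prop. 3.4, 3.6] -/
theorem UnitaryFive.eq_top [FiniteDimensional ℂ W] {𝔊 : Submodule ℂ (Module.End ℂ W)}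
    (hbr : ∀ Y ∈ 𝔊, ∀ Z ∈ 𝔊, Y * Z - Z * Y ∈ 𝔊)
    (hirr : ∀ U : Submodule ℂ W, (∀ A ∈ 𝔊, ∀ u ∈ U, A u ∈ U) → U = ⊥ ∨ U = ⊤)
    {Θ : Module.End ℂ W} (hΘ : Θ ∈ 𝔊) (hΘΘ : Θ * Θ = 1)
    {P Q : Submodule ℂ W} (hP : ∀ x, x ∈ P ↔ Θ x = x) (hQ : ∀ x, x ∈ Q ↔ Θ x = -x)
    (hP5 : Module.finrank ℂ P = 5) (hQmod : Module.finrank ℂ Q % 5 = 2 ∨ Module.finrank ℂ Q % 5 = 4)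
    {s : W → W → ℂ} (hadd : ∀ x y z, s (x + y) z = s x z + s y z) (hsymm : ∀ x y, s y x = starRingEnd ℂ (s x y))
    (hPQ : ∀ p ∈ P, ∀ q ∈ Q, s p q = 0) (hdefP : ∀ p ∈ P, s p p = 0 → p = 0) (hdefQ : ∀ q ∈ Q, s q q = 0 → q = 0)
    (hadj : ∀ X ∈ 𝔊, ∃ Y ∈ 𝔊, ∀ x y, s (X x) y = s x (Y y)) : 𝔊 = ⊤ :=
  UnitaryFive.eq_top_aux _ hbr hirr hΘ hΘΘ hP hQ hP5 rfl hQmod hadd hsymm hPQ hdefP hdefQ hadj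

/-- **The mirror `(b | 5)`, `b ≡ 2, 4 (mod 5)`** (apply `eq_top` to `−Θ`). [cite: Ribet1983, Thm. 3]
[cite: Gordon1997, Thm. 6.3 (3)] -/
theorem UnitaryFive.eq_top' [FiniteDimensional ℂ W] {𝔊 : Submodule ℂ (Module.End ℂ W)}
    (hbr : ∀ Y ∈ 𝔊, ∀ Z ∈ 𝔊, Y * Z - Z * Y ∈ 𝔊)
    (hirr : ∀ U : Submodule ℂ W, (∀ A ∈ 𝔊, ∀ u ∈ U, A u ∈ U) → U = ⊥ ∨ U = ⊤)
    {Θ : Module.End ℂ W} (hΘ : Θ ∈ 𝔊) (hΘΘ : Θ * Θ = 1)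
    {P Q : Submodule ℂ W} (hP : ∀ x, x ∈ P ↔ Θ x = x) (hQ : ∀ x, x ∈ Q ↔ Θ x = -x)
    (hPmod : Module.finrank ℂ P % 5 = 2 ∨ Module.finrank ℂ P % 5 = 4) (hQ5 : Module.finrank ℂ Q = 5)
    {s : W → W → ℂ} (hadd : ∀ x y z, s (x + y) z = s x z + s y z) (hsymm : ∀ x y, s y x = starRingEnd ℂ (s x y))
    (hPQ : ∀ p ∈ P, ∀ q ∈ Q, s p q = 0) (hdefP : ∀ p ∈ P, s p p = 0 → p = 0) (hdefQ : ∀ q ∈ Q, s q q = 0 → q = 0)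
    (hadj : ∀ X ∈ 𝔊, ∃ Y ∈ 𝔊, ∀ x y, s (X x) y = s x (Y y)) : 𝔊 = ⊤ := by
  have hnΘ : -Θ ∈ 𝔊 := Submodule.neg_mem _ hΘ
  have hnΘΘ : (-Θ) * (-Θ) = 1 := by rw [neg_mul_neg, hΘΘ]
  exact UnitaryFive.eq_top hbr hirr hnΘ hnΘΘ (P := Q) (Q := P)
    (fun x => by rw [hQ, LinearMap.neg_apply, neg_eq_iff_eq_neg]) (fun x => by rw [hP, LinearMap.neg_apply, neg_inj])
    hQ5 hPmod hadd hsymm (fun q hq p hp => by rw [hsymm, hPQ p hp q hq, map_zero]) hdefQ hdefP hadj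

end Main

end HodgeStructure

end Literature.AlgebraicGeometry.Motives

end
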